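import Summits.Parity.GeneralizedHardyLittlewood.Theses.JordanCorner
import Literature.NumberTheory.Sieve.DivisorBound

/-!
# `JordanCorner.DiscGrowth` forces the one-form growth bound (shift averaging)

Negative-lane support lemma for the crux `DiscGrowth` (stmt-Parity-12795) of route JordanCorner
(refuter route review, 2026-08-17). The route quantifies `DiscGrowth` over `t ≥ 2` only, so that —
in the thesis' words — "no GRH-type hypothesis enters at `t = 1`". It enters anyway: summing the
`t = 2`, `L = 3` instances of `DiscGrowth` for the shifted pairs `Ψ_b = (n, n + b)` over ALL shifts
`0 < |b| ≤ N` (each admissible: non-degenerate, `‖Ψ_b‖_N = 2 + |b|/N ≤ 3`, `K_b` an interval)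
reassembles the square of the one-form sum,
`(∑_{2 ≤ n ≤ N} J̃_z(n))² = ∑_{|b| ≤ N} ∑_{n, n + b ∈ [2, N]} J̃_z(n) J̃_z(n + b)`,
`J̃_z(m) = ∑_{d ∣ m} μ(d) d^{-z}`, whose diagonal `b = 0` is `≤ ∑_n τ(n)² n^{2ρ} ≤ C² N^{3/2}` for
`ρ ≤ 1/8` (divisor bound). Hence `DiscGrowth` implies the `t = 1` growth statement
`|∑_{2 ≤ n ≤ N} J̃_z(n)| ≤ N^{1+κ}` on a disc `‖z‖ ≤ ρ` (`discGrowth_oneFormGrowth`), which by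
Landau's theorem applied to `∑_n J̃_z(n) n^{-s} = ζ(s)/ζ(s + z)` at `z = -ρ` is a quasi-Riemann
hypothesis `ζ(s) ≠ 0` on `Re s > 1 - ρ` (not formalised here; compare the tree's PROVED barrier
record `Literature.Barriers.Parity.GoldbachAverageZeros`, which ties power savings in binary prime
sums to zero-free half-planes). No statement of the route is refuted; the lemma calibrates the crux.
-/

noncomputable section

namespace Summit.Parity.GeneralizedHardyLittlewood.Theorems.JordanCornerNegative

open Finset Literature.NumberTheory.Sieve

/-! Conventions (written out in full in every statement; no auxiliary definitions):
`J̃_z(n) = ∑_{d ∣ n} μ(d) d^{-z}` for an integer `n` (`Nat.divisors (Int.toNat n)`, empty for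
`n ≤ 0`);
`Ψ_b = ![(n), (n + b)]`, the shifted pair system on `ℤ` (`d = 1`, `t = 2`);
`K_b = [max(2, 2 - b), min(N, N - b)] ⊆ ℝ¹`, on which both forms of `Ψ_b` lie in `[2, N]`;
`S_b(z) = ∑_{2 ≤ n ≤ N, 2 ≤ n + b ≤ N} J̃_z(n) J̃_z(n + b)`, the shift-`b` correlation. -/

/-- `Ψ_b = (n, n + b)` is non-degenerate for `b ≠ 0`. [folklore] -/
theorem isNondegenerateSystem_pairSys {b : ℤ} (hb : b ≠ 0) :
    IsNondegenerateSystem (![⟨fun _ => 1, 0⟩, ⟨fun _ => 1, b⟩] : Fin 2 → AffLinForm 1) := by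
  refine ⟨fun i h => ?_, fun i j hij a c hac => ?_⟩
  · have h0 := congrFun h 0
    fin_cases i <;> simp at h0
  · have h0 := hac (fun _ => 0)
    have h1 := hac (fun _ => 1)
    fin_cases i <;> fin_cases j <;> simp_all [AffLinForm.eval]

/-- `‖Ψ_b‖_N = 2 + |b|/N ≤ 3` for `|b| ≤ N`, `N ≥ 1`. [folklore] -/
theorem affLinSize_pairSys_le {b : ℤ} {N : ℕ} (hN : 1 ≤ N) (hb : |b| ≤ N) :
    affLinSize (![⟨fun _ => 1, 0⟩, ⟨fun _ => 1, b⟩] : Fin 2 → AffLinForm 1) N ≤ ((3 : ℕ) : ℝ) := by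
  have hN' : (0 : ℝ) < N := by exact_mod_cast hN
  have hbR : |(b : ℝ)| ≤ N := by rw [← Int.cast_abs]; exact_mod_cast hb
  have hdiv : |(b : ℝ)| / N ≤ 1 := (div_le_one hN').2 hbR
  simp [affLinSize, Fin.sum_univ_two, abs_div, abs_of_pos hN']
  linarith

/-- `K_b` is convex. [folklore] -/
theorem convex_pairBox (b : ℤ) (N : ℕ) : Convex ℝ (Set.Icc (fun _ : Fin 1 => ((max 2
    (2 - b) : ℤ) : ℝ)) (fun _ : Fin 1 => ((min (N : ℤ) (N - b) : ℤ) : ℝ))) := convex_Icc _ _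

/-- `K_b ⊆ [-N, N]`. [folklore] -/
theorem pairBox_subset (b : ℤ) (N : ℕ) : (Set.Icc (fun _ : Fin 1 => ((max 2 (2 - b) : ℤ) : ℝ))
    (fun _ : Fin 1 => ((min (N : ℤ) (N - b) : ℤ) : ℝ))) ⊆ realBox 1 N := by
  refine Set.Icc_subset_Icc (fun _ => ?_) (fun _ => ?_)
  · show -((N : ℕ) : ℝ) ≤ ((max 2 (2 - b) : ℤ) : ℝ)
    have : ((-(N : ℤ) : ℤ) : ℝ) ≤ ((max 2 (2 - b) : ℤ) : ℝ) :=
      Int.cast_le.2 (le_trans (by omega) (le_max_left _ _))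
    simpa using this
  · show ((min (N : ℤ) (N - b) : ℤ) : ℝ) ≤ ((N : ℕ) : ℝ)
    have : ((min (N : ℤ) (N - b) : ℤ) : ℝ) ≤ ((N : ℤ) : ℝ) := Int.cast_le.2 (min_le_left _ _)
    exact_mod_cast this

/-- Membership in the filtered lattice box of `K_b`. [folklore] -/
theorem mem_filter_pairBox {b : ℤ} {N : ℕ} {v : Fin 1 → ℤ}
    [DecidablePred (fun n : Fin 1 → ℤ => realPoint n ∈ (Set.Icc (fun _ : Fin 1 => ((max 2
        (2 - b) : ℤ) : ℝ)) (fun _ : Fin 1 => ((min (N : ℤ) (N - b) : ℤ) : ℝ))))] :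
    v ∈ (latticeBox 1 N).filter (fun n => realPoint n ∈ (Set.Icc (fun _ : Fin 1 => ((max 2
        (2 - b) : ℤ) : ℝ)) (fun _ : Fin 1 => ((min (N : ℤ) (N - b) : ℤ) : ℝ)))) ↔
      (2 ≤ v 0 ∧ v 0 ≤ N) ∧ (2 ≤ v 0 + b ∧ v 0 + b ≤ N) := by
  simp only [Finset.mem_filter, latticeBox, Fintype.mem_piFinset, Finset.mem_Icc,
    realPoint, Set.mem_Icc, Pi.le_def, Fin.forall_fin_one, Int.cast_le, Int.cast_max,
    Int.cast_min, max_le_iff, le_min_iff]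
  omega

/-- The slice identity: the `DiscGrowth` box sum of `Ψ_b` over `K_b` is `S_b(z)`. [folklore] -/
theorem boxSum_pairSys (z : ℂ) (N : ℕ) (b : ℤ)
    [DecidablePred (fun n : Fin 1 → ℤ => realPoint n ∈ (Set.Icc (fun _ : Fin 1 => ((max 2
        (2 - b) : ℤ) : ℝ)) (fun _ : Fin 1 => ((min (N : ℤ) (N - b) : ℤ) : ℝ))))] :
    (∑ n ∈ (latticeBox 1 N).filter (fun n => realPoint n ∈ (Set.Icc (fun _ : Fin 1 => ((max 2
        (2 - b) : ℤ) : ℝ)) (fun _ : Fin 1 => ((min (N : ℤ) (N - b) : ℤ) : ℝ)))),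
      ∏ i : Fin 2, (if ((![⟨fun _ => 1, 0⟩, ⟨fun _ => 1, b⟩] : Fin 2 →
          AffLinForm 1) i).eval n < 2 then (0 : ℂ) else
        ∑ d ∈ Nat.divisors (((![⟨fun _ => 1, 0⟩, ⟨fun _ => 1, b⟩] : Fin 2 →
            AffLinForm 1) i).eval n).toNat,
          (ArithmeticFunction.moebius d : ℂ) * ((d : ℕ) : ℂ) ^ (-z))) = (∑ n ∈ Finset.filter
              (fun n : ℤ => 2 ≤ n + b ∧ n + b ≤ (N : ℤ)) (Icc (2 : ℤ) N), (∑ d ∈ Nat.divisors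
              (Int.toNat n), (ArithmeticFunction.moebius d : ℂ) * ((d : ℕ) : ℂ) ^ (-z)) *
              (∑ d ∈ Nat.divisors (Int.toNat (n + b)), (ArithmeticFunction.moebius d : ℂ) *
              ((d : ℕ) : ℂ) ^ (-z))) := by
  refine Finset.sum_nbij' (fun v => v 0) (fun n _ => n) ?_ ?_ ?_ ?_ ?_
  · intro v hv
    have hv' := (mem_filter_pairBox (b := b) (N := N) (v := v)).1 hv
    simp only [Finset.mem_filter, Finset.mem_Icc]
    exact hv'
  · intro n hn
    simp only [Finset.mem_filter, Finset.mem_Icc] at hn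
    exact (mem_filter_pairBox (b := b) (N := N) (v := fun _ => n)).2 hn
  · intro v _
    funext k
    rw [Fin.fin_one_eq_zero k]
  · intro n _
    rfl
  · intro v hv
    have hv' := (mem_filter_pairBox (b := b) (N := N) (v := v)).1 hv
    have e0 : ((![⟨fun _ => 1, 0⟩, ⟨fun _ => 1, b⟩] : Fin 2 → AffLinForm 1) 0).eval v =
        v 0 := by simp [AffLinForm.eval]
    have e1 : ((![⟨fun _ => 1, 0⟩, ⟨fun _ => 1, b⟩] : Fin 2 → AffLinForm 1) 1).eval v =
        v 0 + b := by simp [AffLinForm.eval]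
    rw [Fin.prod_univ_two, e0, e1, if_neg (by omega), if_neg (by omega)]

/-- Shift averaging: `(∑_{2 ≤ n ≤ N} J̃_z(n))² = ∑_{|b| ≤ N} S_b(z)`. [folklore] -/
theorem sq_oneForm_eq (z : ℂ) (N : ℕ) :
    (∑ n ∈ Icc (2 : ℤ) N, (∑ d ∈ Nat.divisors (Int.toNat n), (ArithmeticFunction.moebius d : ℂ) *
        ((d : ℕ) : ℂ) ^ (-z))) ^ 2 = ∑ b ∈ Icc (-(N : ℤ)) N, (∑ n ∈ Finset.filter (fun n : ℤ => 2 ≤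
        n + b ∧ n + b ≤ (N : ℤ)) (Icc (2 : ℤ) N), (∑ d ∈ Nat.divisors (Int.toNat n),
        (ArithmeticFunction.moebius d : ℂ) * ((d : ℕ) : ℂ) ^ (-z)) * (∑ d ∈ Nat.divisors
        (Int.toNat (n + b)), (ArithmeticFunction.moebius d : ℂ) * ((d : ℕ) : ℂ) ^ (-z))) := by
  rw [sq, Finset.sum_mul_sum]
  have key : ∀ n ∈ Icc (2 : ℤ) N, ∑ m ∈ Icc (2 : ℤ) N, (∑ d ∈ Nat.divisors (Int.toNat n),
      (ArithmeticFunction.moebius d : ℂ) * ((d : ℕ) : ℂ) ^ (-z)) * (∑ d ∈ Nat.divisors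
      (Int.toNat m), (ArithmeticFunction.moebius d : ℂ) * ((d : ℕ) : ℂ) ^ (-z)) =
      ∑ b ∈ Icc (-(N : ℤ)) N, if (2 ≤ n + b ∧ n + b ≤ N) then (∑ d ∈ Nat.divisors (Int.toNat n),
          (ArithmeticFunction.moebius d : ℂ) * ((d : ℕ) : ℂ) ^ (-z)) * (∑ d ∈ Nat.divisors
          (Int.toNat (n + b)), (ArithmeticFunction.moebius d : ℂ) * ((d : ℕ) : ℂ) ^
          (-z)) else 0 := by
    intro n hn
    rw [Finset.mem_Icc] at hn
    rw [← Finset.sum_filter]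
    refine Finset.sum_nbij' (fun m => m - n) (fun b => n + b) ?_ ?_ ?_ ?_ ?_
    · intro m hm
      simp only [Finset.mem_Icc] at hm
      simp only [Finset.mem_filter, Finset.mem_Icc]
      omega
    · intro c hc
      simp only [Finset.mem_filter, Finset.mem_Icc] at hc
      simp only [Finset.mem_Icc]
      omega
    · intro m _
      ring
    · intro c _
      ring
    · intro m _
      rw [add_sub_cancel]
  rw [Finset.sum_congr rfl key, Finset.sum_comm]
  refine Finset.sum_congr rfl fun b _ => ?_
  rw [Finset.sum_filter]

/-- Trivial bound `|J̃_z(n)| ≤ τ(n) n^ρ` for `‖z‖ ≤ ρ`. [folklore] -/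
theorem norm_jt_le {z : ℂ} {ρ : ℝ} (hρ : 0 ≤ ρ) (hz : ‖z‖ ≤ ρ) (n : ℤ) :
    ‖(∑ d ∈ Nat.divisors (Int.toNat n), (ArithmeticFunction.moebius d : ℂ) * ((d : ℕ) : ℂ) ^
        (-z))‖ ≤ (Nat.divisors n.toNat).card * (n.toNat : ℝ) ^ ρ := by
  refine (norm_sum_le _ _).trans ?_
  have key : ∀ d ∈ Nat.divisors n.toNat,
      ‖(ArithmeticFunction.moebius d : ℂ) * ((d : ℕ) : ℂ) ^ (-z)‖ ≤ (n.toNat : ℝ) ^ ρ := by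
    intro d hd
    have hd0 : 0 < d := Nat.pos_of_mem_divisors hd
    have hdn : d ≤ n.toNat := Nat.divisor_le hd
    rw [norm_mul, Complex.norm_natCast_cpow_of_pos hd0]
    have h1 : ‖(ArithmeticFunction.moebius d : ℂ)‖ ≤ 1 := by
      rw [Complex.norm_intCast]
      have := ArithmeticFunction.abs_moebius_le_one (n := d)
      exact_mod_cast this
    have h2 : (d : ℝ) ^ (-z).re ≤ (n.toNat : ℝ) ^ ρ := by
      calc (d : ℝ) ^ (-z).re ≤ (d : ℝ) ^ ρ := by
            refine Real.rpow_le_rpow_of_exponent_le (by exact_mod_cast hd0) ?_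
            rw [Complex.neg_re]
            exact (neg_le_abs _).trans ((Complex.abs_re_le_norm z).trans hz)
        _ ≤ (n.toNat : ℝ) ^ ρ := Real.rpow_le_rpow (by positivity) (by exact_mod_cast hdn) hρ
    calc ‖(ArithmeticFunction.moebius d : ℂ)‖ * (d : ℝ) ^ (-z).re ≤ 1 * (n.toNat : ℝ) ^ ρ :=
          mul_le_mul h1 h2 (by positivity) zero_le_one
      _ = _ := one_mul _
  refine (Finset.sum_le_sum key).trans ?_
  rw [Finset.sum_const, nsmul_eq_mul]

/-- The diagonal `b = 0`: `|S_0(z)| ≤ C² N^{3/2}` for `‖z‖ ≤ 1/8`, `C` a divisor-bound constant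
at exponent `1/8`. [folklore] -/
theorem norm_shiftSum_zero_le {z : ℂ} (hz : ‖z‖ ≤ 1 / 8) {C : ℝ} (hC1 : 1 ≤ C)
    (hC : ∀ n : ℕ, n ≠ 0 → ((Nat.divisors n).card : ℝ) ≤ C * (n : ℝ) ^ (1 / 8 : ℝ)) (N : ℕ) :
    ‖(∑ n ∈ Finset.filter (fun n : ℤ => 2 ≤ n + 0 ∧ n + 0 ≤ (N : ℤ)) (Icc (2 : ℤ) N),
        (∑ d ∈ Nat.divisors (Int.toNat n), (ArithmeticFunction.moebius d : ℂ) * ((d : ℕ) : ℂ) ^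
        (-z)) * (∑ d ∈ Nat.divisors (Int.toNat (n + 0)), (ArithmeticFunction.moebius d : ℂ) *
        ((d : ℕ) : ℂ) ^ (-z)))‖ ≤ C ^ 2 * (N : ℝ) ^ (3 / 2 : ℝ) := by
  refine (norm_sum_le _ _).trans ?_
  have hb : ∀ n ∈ (Icc (2 : ℤ) N).filter (fun n : ℤ => 2 ≤ n + 0 ∧ n + 0 ≤ (N : ℤ)),
      ‖(∑ d ∈ Nat.divisors (Int.toNat n), (ArithmeticFunction.moebius d : ℂ) * ((d : ℕ) : ℂ) ^
          (-z)) * (∑ d ∈ Nat.divisors (Int.toNat (n + 0)), (ArithmeticFunction.moebius d : ℂ) *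
          ((d : ℕ) : ℂ) ^ (-z))‖ ≤ C ^ 2 * (N : ℝ) ^ (1 / 2 : ℝ) := by
    intro n hn
    simp only [Finset.mem_filter, Finset.mem_Icc] at hn
    obtain ⟨⟨hn2, hnN⟩, -⟩ := hn
    have hm0 : n.toNat ≠ 0 := by omega
    have hmN : (n.toNat : ℝ) ≤ N := by exact_mod_cast (show n.toNat ≤ N by omega)
    have hC0 : 0 ≤ C := zero_le_one.trans hC1
    have hj : ‖(∑ d ∈ Nat.divisors (Int.toNat n), (ArithmeticFunction.moebius d : ℂ) *
        ((d : ℕ) : ℂ) ^ (-z))‖ ≤ C * (N : ℝ) ^ (1 / 4 : ℝ) := by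
      calc ‖(∑ d ∈ Nat.divisors (Int.toNat n), (ArithmeticFunction.moebius d : ℂ) *
          ((d : ℕ) : ℂ) ^ (-z))‖ ≤ (Nat.divisors n.toNat).card * (n.toNat : ℝ) ^ (1 / 8 : ℝ) :=
            norm_jt_le (by norm_num) hz n
        _ ≤ (C * (n.toNat : ℝ) ^ (1 / 8 : ℝ)) * (n.toNat : ℝ) ^ (1 / 8 : ℝ) := by
            gcongr
            exact hC n.toNat hm0
        _ = C * ((n.toNat : ℝ) ^ (1 / 8 : ℝ) * (n.toNat : ℝ) ^ (1 / 8 : ℝ)) := by ring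
        _ = C * (n.toNat : ℝ) ^ (1 / 4 : ℝ) := by
            rw [← Real.rpow_add' (by positivity) (by norm_num)]
            norm_num
        _ ≤ C * (N : ℝ) ^ (1 / 4 : ℝ) := by gcongr
    rw [add_zero, norm_mul]
    calc ‖(∑ d ∈ Nat.divisors (Int.toNat n), (ArithmeticFunction.moebius d : ℂ) * ((d : ℕ) : ℂ) ^
        (-z))‖ * ‖(∑ d ∈ Nat.divisors (Int.toNat n), (ArithmeticFunction.moebius d : ℂ) *
        ((d : ℕ) : ℂ) ^ (-z))‖ ≤ (C * (N : ℝ) ^ (1 / 4 : ℝ)) * (C * (N : ℝ) ^ (1 / 4 : ℝ)) :=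
          mul_le_mul hj hj (norm_nonneg _) (by positivity)
      _ = C ^ 2 * ((N : ℝ) ^ (1 / 4 : ℝ) * (N : ℝ) ^ (1 / 4 : ℝ)) := by ring
      _ = C ^ 2 * (N : ℝ) ^ (1 / 2 : ℝ) := by
          rw [← Real.rpow_add' (by positivity) (by norm_num)]
          norm_num
  refine (Finset.sum_le_sum hb).trans ?_
  rw [Finset.sum_const, nsmul_eq_mul]
  have hcard : ((((Icc (2 : ℤ) N).filter (fun n : ℤ => 2 ≤ n + 0 ∧ n + 0 ≤ (N : ℤ))).card : ℕ) : ℝ)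
      ≤ N := by
    have h1 := Finset.card_filter_le (Icc (2 : ℤ) N) (fun n : ℤ => 2 ≤ n + 0 ∧ n + 0 ≤ (N : ℤ))
    have h2 : (Icc (2 : ℤ) N).card ≤ N := by
      rw [Int.card_Icc]
      omega
    exact_mod_cast h1.trans h2
  calc (_ : ℝ) * (C ^ 2 * (N : ℝ) ^ (1 / 2 : ℝ)) ≤ (N : ℝ) * (C ^ 2 * (N : ℝ) ^ (1 / 2 : ℝ)) := by
        gcongr
    _ = C ^ 2 * ((N : ℝ) ^ (1 : ℝ) * (N : ℝ) ^ (1 / 2 : ℝ)) := by rw [Real.rpow_one]; ring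
    _ = C ^ 2 * (N : ℝ) ^ (3 / 2 : ℝ) := by
        rw [← Real.rpow_add' (by positivity) (by norm_num)]
        norm_num

/-- The one-form sum `∑_{2 ≤ n ≤ N} J̃_z(n)` over `ℕ` equals the `ℤ`-indexed one (`Int.toNat`).
[folklore] -/
theorem oneForm_nat_eq_int (z : ℂ) (N : ℕ) :
    (∑ n ∈ Finset.Icc 2 N, ∑ d ∈ Nat.divisors n,
        (ArithmeticFunction.moebius d : ℂ) * ((d : ℕ) : ℂ) ^ (-z)) = ∑ n ∈ Icc (2 : ℤ) N,
            (∑ d ∈ Nat.divisors (Int.toNat n), (ArithmeticFunction.moebius d : ℂ) *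
            ((d : ℕ) : ℂ) ^ (-z)) := by
  refine Finset.sum_nbij' (fun n : ℕ => (n : ℤ)) (fun m : ℤ => m.toNat) ?_ ?_ ?_ ?_ ?_
  · intro n hn
    simp only [Finset.mem_Icc] at hn ⊢
    omega
  · intro m hm
    simp only [Finset.mem_Icc] at hm ⊢
    omega
  · intro n _
    simp
  · intro m hm
    simp only [Finset.mem_Icc] at hm
    omega
  · intro n _
    simp

/-- **`DiscGrowth` implies the one-form growth bound** (shift averaging over the `t = 2`, `L = 3`
slices `(n, n + b)`, `0 < |b| ≤ N`): there is `ρ > 0` such that for every `κ > 0`, all large `N` and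
all `‖z‖ ≤ ρ`, `|∑_{2 ≤ n ≤ N} ∑_{d ∣ n} μ(d) d^{-z}| ≤ N^{1+κ}` — the `t = 1` statement the route
deliberately did not file; by Landau's theorem on `ζ(s)/ζ(s+z)` it is a quasi-Riemann hypothesis
`ζ ≠ 0` on `Re s > 1 − ρ` (informal; not formalised here). [folklore] -/
theorem discGrowth_oneFormGrowth (hD : Theses.JordanCorner.DiscGrowth) :
    ∃ ρ : ℝ, 0 < ρ ∧ ∀ κ : ℝ, 0 < κ → ∃ N₀ : ℕ, ∀ N : ℕ, N₀ ≤ N → ∀ z : ℂ, ‖z‖ ≤ ρ →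
      ‖∑ n ∈ Finset.Icc 2 N, ∑ d ∈ Nat.divisors n,
          (ArithmeticFunction.moebius d : ℂ) * ((d : ℕ) : ℂ) ^ (-z)‖ ≤ (N : ℝ) ^ (1 + κ) := by
  classical
  obtain ⟨ρ₀, hρ₀, H⟩ := hD 2 le_rfl 3
  obtain ⟨C, hC1, hC⟩ := exists_card_divisors_le_mul_rpow (ε := (1 / 8 : ℝ)) (by norm_num)
  refine ⟨min ρ₀ (1 / 8), lt_min hρ₀ (by norm_num), fun κ hκ => ?_⟩
  obtain ⟨N₀, hN₀⟩ := H κ hκ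
  refine ⟨max N₀ (max 1 ⌈(3 + C ^ 2) ^ κ⁻¹⌉₊), fun N hN z hz => ?_⟩
  have hNN₀ : N₀ ≤ N := le_trans (le_max_left _ _) hN
  have hN1 : 1 ≤ N := le_trans ((le_max_left _ _).trans (le_max_right _ _)) hN
  have hNceil : ⌈(3 + C ^ 2) ^ κ⁻¹⌉₊ ≤ N :=
    le_trans ((le_max_right _ _).trans (le_max_right _ _)) hN
  have hNpos : (0 : ℝ) < N := by exact_mod_cast hN1
  have hN1R : (1 : ℝ) ≤ N := by exact_mod_cast hN1
  have hzρ : ‖z‖ ≤ ρ₀ := hz.trans (min_le_left _ _)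
  have hz8 : ‖z‖ ≤ 1 / 8 := hz.trans (min_le_right _ _)
  have hC0 : 0 ≤ C := zero_le_one.trans hC1
  -- `N^κ ≥ 3 + C²`
  have hpow : 3 + C ^ 2 ≤ (N : ℝ) ^ κ := by
    have h1 : (3 + C ^ 2) ^ κ⁻¹ ≤ (N : ℝ) := (Nat.le_ceil _).trans (by exact_mod_cast hNceil)
    calc 3 + C ^ 2 = ((3 + C ^ 2) ^ κ⁻¹) ^ κ := by rw [Real.rpow_inv_rpow (by positivity) hκ.ne']
      _ ≤ (N : ℝ) ^ κ := Real.rpow_le_rpow (by positivity) h1 hκ.le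
  -- the off-diagonal slices, from `DiscGrowth` at `t = 2`, `L = 3`
  have hslice : ∀ b ∈ (Icc (-(N : ℤ)) N).erase 0, ‖(∑ n ∈ Finset.filter (fun n : ℤ => 2 ≤ n + b ∧
      n + b ≤ (N : ℤ)) (Icc (2 : ℤ) N), (∑ d ∈ Nat.divisors (Int.toNat n),
      (ArithmeticFunction.moebius d : ℂ) * ((d : ℕ) : ℂ) ^ (-z)) * (∑ d ∈ Nat.divisors (Int.toNat
      (n + b)), (ArithmeticFunction.moebius d : ℂ) * ((d : ℕ) : ℂ) ^ (-z)))‖ ≤ (N : ℝ) ^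
      (1 + κ) := by
    intro b hb
    rw [Finset.mem_erase, Finset.mem_Icc] at hb
    have hb0 : b ≠ 0 := hb.1
    have hbN : |b| ≤ N := abs_le.2 hb.2
    have := hN₀ N hNN₀ (![⟨fun _ => 1, 0⟩, ⟨fun _ => 1, b⟩] : Fin 2 → AffLinForm 1)
        (isNondegenerateSystem_pairSys hb0)
      (affLinSize_pairSys_le hN1 hbN) (Set.Icc (fun _ : Fin 1 => ((max 2 (2 - b) : ℤ) : ℝ))
          (fun _ : Fin 1 => ((min (N : ℤ) (N - b) : ℤ) : ℝ))) (convex_pairBox b N)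
          (pairBox_subset b N) z hzρ
    rwa [boxSum_pairSys] at this
  -- the diagonal
  have hdiag : ‖(∑ n ∈ Finset.filter (fun n : ℤ => 2 ≤ n + 0 ∧ n + 0 ≤ (N : ℤ)) (Icc (2 : ℤ) N),
      (∑ d ∈ Nat.divisors (Int.toNat n), (ArithmeticFunction.moebius d : ℂ) * ((d : ℕ) : ℂ) ^
      (-z)) * (∑ d ∈ Nat.divisors (Int.toNat (n + 0)), (ArithmeticFunction.moebius d : ℂ) *
      ((d : ℕ) : ℂ) ^ (-z)))‖ ≤ C ^ 2 * (N : ℝ) ^ (3 / 2 : ℝ) := norm_shiftSum_zero_le hz8 hC1 hC N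
  -- assemble
  rw [oneForm_nat_eq_int]
  obtain ⟨T, hT⟩ : ∃ T : ℂ, T = ∑ n ∈ Icc (2 : ℤ) N, (∑ d ∈ Nat.divisors (Int.toNat n),
      (ArithmeticFunction.moebius d : ℂ) * ((d : ℕ) : ℂ) ^ (-z)) := ⟨_, rfl⟩
  rw [← hT]
  have hT2 : T ^ 2 = ∑ b ∈ Icc (-(N : ℤ)) N, (∑ n ∈ Finset.filter (fun n : ℤ => 2 ≤ n + b ∧ n + b ≤
      (N : ℤ)) (Icc (2 : ℤ) N), (∑ d ∈ Nat.divisors (Int.toNat n),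
      (ArithmeticFunction.moebius d : ℂ) * ((d : ℕ) : ℂ) ^ (-z)) * (∑ d ∈ Nat.divisors (Int.toNat
      (n + b)), (ArithmeticFunction.moebius d : ℂ) * ((d : ℕ) : ℂ) ^
      (-z))) := by rw [hT]; exact sq_oneForm_eq z N
  have h0mem : (0 : ℤ) ∈ Icc (-(N : ℤ)) N := by simp
  have hcard : (((Icc (-(N : ℤ)) N).card : ℕ) : ℝ) ≤ 3 * N := by
    have : (Icc (-(N : ℤ)) N).card = 2 * N + 1 := by
      rw [Int.card_Icc]
      omega
    rw [this]
    push_cast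
    linarith
  have hsq : ‖T‖ ^ 2 ≤ ((N : ℝ) ^ (1 + κ)) ^ 2 := by
    calc ‖T‖ ^ 2 = ‖T ^ 2‖ := (norm_pow T 2).symm
      _ = ‖∑ b ∈ Icc (-(N : ℤ)) N, (∑ n ∈ Finset.filter (fun n : ℤ => 2 ≤ n + b ∧ n + b ≤ (N : ℤ))
          (Icc (2 : ℤ) N), (∑ d ∈ Nat.divisors (Int.toNat n), (ArithmeticFunction.moebius d : ℂ) *
          ((d : ℕ) : ℂ) ^ (-z)) * (∑ d ∈ Nat.divisors (Int.toNat (n + b)),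
          (ArithmeticFunction.moebius d : ℂ) * ((d : ℕ) : ℂ) ^ (-z)))‖ := by rw [hT2]
      _ ≤ ∑ b ∈ Icc (-(N : ℤ)) N, ‖(∑ n ∈ Finset.filter (fun n : ℤ => 2 ≤ n + b ∧ n + b ≤ (N : ℤ))
          (Icc (2 : ℤ) N), (∑ d ∈ Nat.divisors (Int.toNat n), (ArithmeticFunction.moebius d : ℂ) *
          ((d : ℕ) : ℂ) ^ (-z)) * (∑ d ∈ Nat.divisors (Int.toNat (n + b)),
          (ArithmeticFunction.moebius d : ℂ) * ((d : ℕ) : ℂ) ^ (-z)))‖ := norm_sum_le _ _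
      _ = ‖(∑ n ∈ Finset.filter (fun n : ℤ => 2 ≤ n + 0 ∧ n + 0 ≤ (N : ℤ)) (Icc (2 : ℤ) N),
          (∑ d ∈ Nat.divisors (Int.toNat n), (ArithmeticFunction.moebius d : ℂ) * ((d : ℕ) : ℂ) ^
          (-z)) * (∑ d ∈ Nat.divisors (Int.toNat (n + 0)), (ArithmeticFunction.moebius d : ℂ) *
          ((d : ℕ) : ℂ) ^ (-z)))‖ + ∑ b ∈ (Icc (-(N : ℤ)) N).erase 0, ‖(∑ n ∈ Finset.filter
          (fun n : ℤ => 2 ≤ n + b ∧ n + b ≤ (N : ℤ)) (Icc (2 : ℤ) N), (∑ d ∈ Nat.divisors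
          (Int.toNat n), (ArithmeticFunction.moebius d : ℂ) * ((d : ℕ) : ℂ) ^ (-z)) *
          (∑ d ∈ Nat.divisors (Int.toNat (n + b)), (ArithmeticFunction.moebius d : ℂ) *
          ((d : ℕ) : ℂ) ^ (-z)))‖ :=
          (Finset.add_sum_erase _ _ h0mem).symm
      _ ≤ C ^ 2 * (N : ℝ) ^ (3 / 2 : ℝ) + ∑ b ∈ (Icc (-(N : ℤ)) N).erase 0, (N : ℝ) ^ (1 + κ) :=
          add_le_add hdiag (Finset.sum_le_sum hslice)
      _ ≤ C ^ 2 * (N : ℝ) ^ (3 / 2 : ℝ) + ∑ b ∈ Icc (-(N : ℤ)) N, (N : ℝ) ^ (1 + κ) :=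
          add_le_add le_rfl (Finset.sum_le_sum_of_subset_of_nonneg (f := fun _ => (N : ℝ) ^ (1 + κ))
            (Finset.erase_subset _ _) (fun i _ _ => by positivity))
      _ = C ^ 2 * (N : ℝ) ^ (3 / 2 : ℝ) + ((Icc (-(N : ℤ)) N).card : ℝ) * (N : ℝ) ^ (1 + κ) := by
          rw [Finset.sum_const, nsmul_eq_mul]
      _ ≤ C ^ 2 * (N : ℝ) ^ (2 + κ) + (3 * N) * (N : ℝ) ^ (1 + κ) :=
          add_le_add
            (mul_le_mul_of_nonneg_left (Real.rpow_le_rpow_of_exponent_le hN1R (by linarith))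
              (by positivity))
            (mul_le_mul_of_nonneg_right hcard (by positivity))
      _ = (3 + C ^ 2) * (N : ℝ) ^ (2 + κ) := by
          have : (N : ℝ) * (N : ℝ) ^ (1 + κ) = (N : ℝ) ^ (2 + κ) := by
            rw [show (2 : ℝ) + κ = 1 + (1 + κ) by ring, Real.rpow_add hNpos 1 (1 + κ),
                Real.rpow_one]
          rw [mul_assoc, this]
          ring
      _ ≤ (N : ℝ) ^ κ * (N : ℝ) ^ (2 + κ) := by gcongr
      _ = ((N : ℝ) ^ (1 + κ)) ^ 2 := by
          rw [sq, ← Real.rpow_add hNpos, ← Real.rpow_add hNpos]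
          ring_nf
  have h0 : 0 ≤ (N : ℝ) ^ (1 + κ) := by positivity
  exact (pow_le_pow_iff_left₀ (norm_nonneg T) h0 two_ne_zero).1 hsq

end Summit.Parity.GeneralizedHardyLittlewood.Theorems.JordanCornerNegative
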